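import Summits.CriticalPhenomena.PercolationContinuityZ3.Theorems.FK.Transplant.FHFreePercolationTools
import Summits.CriticalPhenomena.PercolationContinuityZ3.Theorems.FK.BernoulliComparison
import Summits.CriticalPhenomena.PercolationContinuityZ3.Theorems.FK.ContinuityTargets
import Summits.CriticalPhenomena.PercolationContinuityZ3.Theorems.FK.NoCriterionAtCritical
import Summits.CriticalPhenomena.PercolationContinuityZ3.Theorems.FK.Transplant.FreeBoundaryTransplantR3
import HarnessLib

/-!
# FRONTIER TRANSPLANT, calibration leaf: the hypothesis of record `FH` FORCES FREE PERCOLATION at the same `p`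
# (`FH d q p → 0 < θ⁰(p,q)`, every `q ≥ 1`), and binder 2 `KNFreeTargetHittable` holds VACUOUSLY wherever `θ⁰(p,q) = 0`

Support file (`--supports stmt-CriticalPhenomena-4575`, helper) of the FRONTIER TRANSPLANT sub-cell
(`fk-continuity/transplant/`, seat `prim-bschramm-fkt-p3`); builds on p205010 (kernel theorem, internal audit signed;
external expert review pending). No definitions, no named facts, no sorries; standard axioms.
Registered R57 (cell INBOX l.4037, 2026-08-22); registry row T1c; lead label T1c-B (fkt-lead L16, l.4045).

HONEST FRAMING (page 1, cell rule). The transplant's theorem of record `ufsc0_of_freeBoundaryHypothesis_r3`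
(p248245, END STATE « 2 / 0 ☑ ») is CONDITIONAL on FH AND on TP_FK = `KNFreeTargetHittable d q p`, both OPEN at the
same `p` for `q > 1` NEAR `p_c(q)` (⇔ GRC Conj. (5.103) via K1; barrier note
`Literature.Barriers.CriticalPhenomena.SamePFreeBoundaryCriteria`, FBN-01, cited first); the transplant is a typed
reduction, not a proof of FK continuity, and THIS FILE DOES NOT CHANGE THAT: it proves NOTHING toward FH or TP_FK
in the percolative regime `θ⁰(p,q) > 0`. It is a CALIBRATION leaf — the kernel form of two sentences so far carried
only in prose: the docstring of `FH` (`FreeBoundaryHypotheses.lean`: "it FAILS at `p_c(q)` wherever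
`θ⁰(p_c(q), q) = 0`") and `not_fh_and_targetHittable_at_critical` (`KNFreeTheorem6Consequences.lean`, lead ruling
L8: "at `p = p_c(q)` FH and TP_FK do not both hold — silent on which of the two fails").

## What is proved (every `q ≥ 1`; `θ⁰ = thetaFree`, the tree's free percolation probability, Grimmett (5.1))

* `thetaFree_pos_of_isHittableFK` — **one FK-hittable geometry forces free percolation**: `IsHittableFK q p g →
  0 < θ⁰(p,q)` (`d ≥ 1`). Printed argument (Grimmett 2006, Thm. (3.7) + (3.4) + (3.22)/(4.13) + (5.1)), tools in
  `FHFreePercolationTools.lean`: the free look of `g` is the free law of `ℓQ` CONDITIONED on the seed edges being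
  open; that costs at most `π^{-#E(Λ_m)}`, `π = p/(p+q(1-p))`; the free law of `ℓQ` is dominated on increasing events
  by the free law of any larger box, under which "a given vertex of `Λ_m` is joined to distance `n`" has the
  tree's free box probability `thetaFreeBox d p q n k`; so `θ⁰(p,q) = 0` (`thetaFree_eq_zero_iff_mem_freeDecaySet`)
  makes the look probability `≤ 1/4` at FIXED `m` for large `ℓ`, against `> 1/2` from FK-hittability.
* `thetaFree_pos_of_fh`, `rcCriticalProb_le_of_fh` — **`FH d q p → 0 < θ⁰(p,q)` and `FH d q p → p_c(q) ≤ p`**; with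
  T1 (`fh_of_criticalProb_lt_ratio`): `p_c(q) ≤ inf {p | FH d q p} ≤ q·p_c(ℤ^d)/(1+(q-1)·p_c(ℤ^d))`;
  `fh_mono_left`: `{p | FH d q p}` is an up-set.
* `knFreeTargetHittable_of_forall_not_isHittableFK`, `knFreeTargetHittable_of_thetaFree_eq_zero` — **binder 2 is
  VACUOUS off the percolative phase** (`δ = 1`, `R = 0`: a target w.r.t. a family of FK-hittable geometries, now
  empty, forces an empty box). TP_FK has content only where `θ⁰(p,q) > 0`.
* AT `p = p_c(q)`: `not_fh_at_critical_of_fkContinuityFree`, `knFreeTargetHittable_at_critical_of_fkContinuityFree`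
  — **if the free transition is continuous (`FKContinuityFree d q`, the cell's deciding target T_F) then binder 1
  FAILS and binder 2 HOLDS (vacuously) at `p_c(q)`** — the alternative left open by
  `not_fh_and_targetHittable_at_critical`, decided wherever T_F is known: UNCONDITIONALLY for `q = 2`, `d ≥ 3`
  (`FK.free_two`, ADS 2015 — `not_fh_two_at_critical`: at the FK–Ising critical point of the cell's motivation the
  transplant's hypothesis `FH 3 2 p_c(2)` is false) and for `q > Q(d)`, `d ≥ 2` (`fkContinuityFree_of_large_q`,
  Grimmett Thm. (7.33)(b) — `not_fh_at_critical_of_large_q`).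

* `fkCriterionOfThetaFree_of_converse` — **K1 as a kernel statement**: the record `_r3` plus the CONVERSE
  `0 < θ⁰(p,q) → FH d q p ∧ KNFreeTargetHittable d q p` (all `p ∈ (0,1)`; OPEN, displayed hypothesis) give the cell's
  crux C3a `FKCriterionOfThetaFree d q ε₀` (`d ≥ 3`). CONDITIONAL; consumes `_r3` as L8's leaf does.

Calibration value (K1, one direction made kernel): C3a's hypothesis `0 < θ⁰(p,q)` (`FKCriterionOfThetaFree`) is
NECESSARY for binder 1 (`thetaFree_pos_of_fh`), and C3a follows from the record once the CONVERSE holds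
(`fkCriterionOfThetaFree_of_converse`): the programme's open content is exactly `0 < θ⁰(p,q) ⇒ FH ∧ TP_FK` near
`p_c(q)` (GRC Conj. (5.103)-calibre). NOT a discharge, NOT `_r4`; record « 2 / 0 ☑ », n_open = 2, BINDER-OWNERS and
FO-19 NO-GO unchanged. Infinite-volume objects: NONE (`thetaFree = inf_n sup_k` of free BOX probabilities), T1⁺.

## References

* G. Grimmett, *The Random-Cluster Model*, Springer 2006: Thm. (3.1) eq. (3.4), Thm. (3.7), Thm. (3.21) eq. (3.22),
  Lemma (4.13), §5.1 (5.1)–(5.3), Conj. (5.103), Conj. (6.32)(a), Thm. (7.33)(b). [Grimmett2006]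
* G. Kozma, S. Nitzan, arXiv:2401.12397 (2024), §4 p. 16 (hittable geometry, target), Lemma 9, Lemma 10. [KozmaNitzan2024]
* M. Aizenman, H. Duminil-Copin, V. Sidoravicius, Comm. Math. Phys. 334 (2015), Thm. 1.2, Cor. 1.5(1).
  [AizenmanDuminilCopinSidoraviciusCMP2015]
-/

noncomputable section

open MeasureTheory
open scoped ENNReal Classical

namespace Summit.CriticalPhenomena.PercolationContinuityZ3.Theorems.FK

open Literature.Probability.Percolation Literature.Probability.LatticeModels SimpleGraph
open Literature.Probability.Percolation.GadgetSystem Literature.Probability.Percolation.KozmaNitzan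
open Literature.Barriers.CriticalPhenomena

variable {d : ℕ}

/-! ### 1. One FK-hittable geometry forces free percolation -/

/-- **One FK-hittable geometry forces free percolation** (`q ≥ 1`, `0 < p`, `d ≥ 1`): `IsHittableFK q p g →
0 < θ⁰(p,q)`. Proof: if `θ⁰(p,q) = 0` the free box probabilities `φ⁰_{Λ_{n+k}}(0 ↔ ∂Λ_n)` are `≤ η` for some `n`
and all `k` (`thetaFree_eq_zero_iff_mem_freeDecaySet`); fix the seed size `m = k₀` of the hittability thresholds and
take `ℓ ≥ ℓ₀` with `m + n < ℓ`; the free look at `(m, ℓ)` is `> 1/2` by hittability, and `≤ π^{-#E(Λ_m)} · #Λ_m · η`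
by `pow_mul_fkLaw_hitW_real_le` (the wired seed costs `π^{-#E(Λ_m)}`), the first-exit inclusion
`linkIn_inter_posOnly_subset_biUnion_toBdryAt` and `fkLaw_restrW_lattW_real_toBdryAt_le` (free region inside a free
ball), all in `FHFreePercolationTools.lean` — a contradiction for `η = π^{#E(Λ_m)}/(4·#Λ_m)`. [cite: Grimmett2006, Thm. (3.7), eq. (3.4), eq. (3.22), Lemma (4.13), §5.1 (5.1); KozmaNitzan2024, §4 p. 16 (hittable geometry)] -/
theorem thetaFree_pos_of_isHittableFK_of_pos [NeZero d] {q : ℝ} (hq : 1 ≤ q) {p : unitInterval} (hp0 : 0 < (p : ℝ))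
    {g : Geom d} (hg : IsHittableFK q p g) : 0 < thetaFree d p q := by
  have hq0 : 0 < q := one_pos.trans_le hq
  by_contra hθ
  have hθ0 : thetaFree d (p : ℝ) q = 0 := le_antisymm (not_lt.1 hθ) (thetaFree_nonneg _ _)
  -- hittability at `ε = 1/2`: thresholds `k₀, ℓ₀`; fix the seed size `m := k₀`
  obtain ⟨k₀, ℓ₀, hhit⟩ := hg.hit (1 / 2) (by norm_num)
  set m := k₀ with hm
  -- the finite-energy price of the seed and the number of starting points
  set π : ℝ := (p : ℝ) / (p + q * (1 - p)) with hπ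
  have hden : 0 < (p : ℝ) + q * (1 - p) := by nlinarith [p.2.2]
  have hπ0 : 0 < π := div_pos hp0 hden
  set B : ℝ := ((GM.ball (0 : Site d) m).card : ℝ) with hB
  have hB0 : 0 < B := by
    rw [hB]; exact_mod_cast Finset.card_pos.2 ⟨0, GM.self_mem_ball 0 m⟩
  -- a uniform bound on the number of seed edges inside any box: all lattice edges inside `Λ_m`
  set E₀ : Finset (Sym2 (Site d)) := edgesIn (zdGraph d) (GM.ball (0 : Site d) m) with hE₀
  set c : ℝ := π ^ E₀.card with hc
  have hc0 : 0 < c := pow_pos hπ0 _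
  -- free decay at level `η := c / (4 B)`
  have hη : 0 < c / (4 * B) := by positivity
  obtain ⟨n, hn⟩ := ((thetaFree_eq_zero_iff_mem_freeDecaySet p.2 hq0).1 hθ0) (c / (4 * B)) hη
  -- the scale: `ℓ ≥ ℓ₀` and `m + n < ℓ`
  set ℓ := max ℓ₀ (m + n + 1) with hℓ
  have hℓ₀ : ℓ₀ ≤ ℓ := le_max_left _ _
  have hmnℓ : m + n ≤ ℓ - 1 := by have := le_max_right ℓ₀ (m + n + 1); omega
  have hℓ1 : ℓ - 1 < ℓ := by have := le_max_right ℓ₀ (m + n + 1); omega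
  set Q := g.Qset ℓ 0 with hQ
  set V := restrW (↑Q : Set (Site d)) (lattW d p) with hV
  set μ := fkLaw Q V q with hμ
  haveI : IsProbabilityMeasure μ := isProbabilityMeasure_fkLaw Q V hq0
  set L := linkIn (↑Q : Set (Site d)) (GM.ball (0 : Site d) m) (g.Fset ℓ 0) with hL
  have hLm : MeasurableSet L := measurableSet_linkIn _ _ _
  -- (a) hittability: the look is `> 1/2`
  have hlook : 1 - 1 / 2 < (fkLaw Q (hitW p g ℓ m 0) q).real L := hhit m le_rfl ℓ hℓ₀
  -- (b) the price of the seed: `c · look ≤ μ(L)`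
  set E' : Finset (Sym2 (Site d)) := edgesIn (zdGraph d) (GM.ball (0 : Site d) m ∩ Q) with hE'
  have hE'card : E'.card ≤ E₀.card := by
    refine Finset.card_le_card fun e he => ?_
    rw [hE', mem_edgesIn_iff] at he
    rw [hE₀, mem_edgesIn_iff]
    exact ⟨he.1, fun z hz => (Finset.mem_inter.1 (he.2 z hz)).1⟩
  have hπ1 : π ≤ 1 := by rw [hπ, div_le_one hden]; nlinarith [p.2.2]
  have hcE' : c ≤ π ^ E'.card := by rw [hc]; exact pow_le_pow_of_le_one hπ0.le hπ1 hE'card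
  have hb : c * (fkLaw Q (hitW p g ℓ m 0) q).real L ≤ μ.real L :=
    (mul_le_mul_of_nonneg_right hcE' measureReal_nonneg).trans (pow_mul_fkLaw_hitW_real_le hq p g ℓ m hLm)
  -- (c) first exit + free region inside free balls: `μ(L) ≤ B · η`
  have hLle : μ.real L ≤ B * (c / (4 * B)) := by
    have hnull : μ.real (LData.PosOnly V)ᶜ = 0 := KNFree.real_fkLaw_compl_posOnly_eq_zero hq Q V
    have h1 : μ.real L ≤ μ.real (L ∩ LData.PosOnly V) + μ.real (LData.PosOnly V)ᶜ := by
      calc μ.real L ≤ μ.real ((L ∩ LData.PosOnly V) ∪ (LData.PosOnly V)ᶜ) :=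
            measureReal_mono (fun ω hω => by
              by_cases h : ω ∈ LData.PosOnly V
              · exact Or.inl ⟨hω, h⟩
              · exact Or.inr h) (measure_ne_top _ _)
        _ ≤ _ := measureReal_union_le _ _
    rw [hnull, add_zero] at h1
    refine h1.trans ((measureReal_mono (linkIn_inter_posOnly_subset_biUnion_toBdryAt p Q (g.Fset ℓ 0) hmnℓ
      (g.disjoint_Fset_ball hℓ1 0)) (measure_ne_top _ _)).trans ?_)
    refine (measureReal_biUnion_finset_le _ _).trans ?_
    -- each starting point: `μ(x ↔ ∂(x+Λ_n)) ≤ thetaFreeBox d p q n k ≤ η`, `Q ⊆ x + Λ_{n+k}`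
    obtain ⟨L₀, hL₀⟩ := exists_forall_subset_box d Q
    have hterm : ∀ x ∈ GM.ball (0 : Site d) m, μ.real (toBdryAt x n x) ≤ c / (4 * B) := by
      intro x hx
      have hQx : Q ⊆ GM.ball x (n + (L₀ + m)) := by
        intro z hz
        have hzL := (mem_box.1 (hL₀ L₀ le_rfl hz))
        rw [GM.mem_ball] at hx ⊢
        intro i
        have h1 := hzL i
        have h2 := hx i
        simp only [Pi.zero_apply, sub_zero] at h2
        push_cast
        constructor <;> omega
      exact (fkLaw_restrW_lattW_real_toBdryAt_le hq p hQx).trans (hn (L₀ + m))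
    calc ∑ x ∈ GM.ball (0 : Site d) m, μ.real (toBdryAt x n x)
        ≤ ∑ x ∈ GM.ball (0 : Site d) m, c / (4 * B) := Finset.sum_le_sum hterm
      _ = B * (c / (4 * B)) := by rw [Finset.sum_const, nsmul_eq_mul, hB]
  -- contradiction: `c/2 < c · look ≤ μ(L) ≤ c/4`
  have hBc : B * (c / (4 * B)) = c / 4 := by field_simp
  rw [hBc] at hLle
  nlinarith [hb, hLle, hlook, hc0]

/-- The degenerate density `p = 0`: no geometry is FK-hittable (the free look has only the seed edges open almost
surely, and `ℓF` lies outside the seed). [cite: KozmaNitzan2024, §4 p. 16 (hittable geometry); Grimmett2006, Thm. (3.1) eq. (3.4)] -/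
theorem not_isHittableFK_of_coe_eq_zero {q : ℝ} (hq : 1 ≤ q) {p : unitInterval} (hp : (p : ℝ) = 0) (g : Geom d) :
    ¬ IsHittableFK q p g := by
  intro hg
  have hq0 : 0 < q := one_pos.trans_le hq
  have hp' : p = 0 := Subtype.ext hp
  obtain ⟨k, ℓ₀, hhit⟩ := hg.hit (1 / 2) (by norm_num)
  set m := k with hm
  set ℓ := max ℓ₀ (m + 1) with hℓ
  have hmℓ : m < ℓ := lt_of_lt_of_le (Nat.lt_succ_self m) (le_max_right _ _)
  have hlook := hhit m le_rfl ℓ (le_max_left _ _)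
  set Q := g.Qset ℓ 0 with hQ
  set μ := fkLaw Q (hitW p g ℓ m 0) q with hμ
  haveI : IsProbabilityMeasure μ := isProbabilityMeasure_fkLaw Q _ hq0
  -- almost surely every open pair has positive weight; but a link to `ℓF` leaves the seed through a pair of weight `0`
  have hnull : μ.real (LData.PosOnly (hitW p g ℓ m 0))ᶜ = 0 := KNFree.real_fkLaw_compl_posOnly_eq_zero hq Q _
  have hempty : linkIn (↑Q : Set (Site d)) (GM.ball (0 : Site d) m) (g.Fset ℓ 0) ∩ LData.PosOnly (hitW p g ℓ m 0) = ∅ := by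
    ext ω
    simp only [Set.mem_inter_iff, Set.mem_empty_iff_false, iff_false, not_and]
    rintro ⟨s, hs, t, ht, hst⟩ hpos
    rw [DCT16.mem_openConnIn_iff_pathIn] at hst
    have htball : t ∉ (↑(GM.ball (0 : Site d) m) : Set (Site d)) := fun h' =>
      Finset.disjoint_left.1 (g.disjoint_Fset_ball hmℓ 0) ht (Finset.mem_coe.1 h')
    obtain ⟨a, b, -, hb, -, hab, -⟩ := hst.exit (R := (↑(GM.ball (0 : Site d) m) : Set (Site d)))
      (Finset.mem_coe.2 hs) htball
    rw [openGraph_adj] at hab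
    refine hpos _ hab.1 ?_
    -- the exit pair is not a seed edge, so its weight is the lattice weight `p = 0` (or `0`)
    have hnot : s(a, b) ∉ (↑(edgesIn (zdGraph d) (GM.ball (0 : Site d) m)) : Set (Sym2 (Site d))) := by
      intro h'
      exact hb (Finset.mem_coe.2 ((mem_edgesIn_iff.1 (Finset.mem_coe.1 h')).2 b (Sym2.mem_mk_right a b)))
    unfold hitW
    by_cases hw : s(a, b) ∈ wireSet (↑Q : Set (Site d))
    · rw [restrW_apply_of_mem _ hw, pinW_apply_of_not_mem _ _ hnot, lattW_mk, hp']
      split_ifs <;> rfl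
    · rw [restrW_apply_of_not_mem _ hw]
  have hzero : μ.real (linkIn (↑Q : Set (Site d)) (GM.ball (0 : Site d) m) (g.Fset ℓ 0)) = 0 := by
    refine le_antisymm ?_ measureReal_nonneg
    calc μ.real (linkIn (↑Q : Set (Site d)) (GM.ball (0 : Site d) m) (g.Fset ℓ 0))
        ≤ μ.real ((linkIn (↑Q : Set (Site d)) (GM.ball (0 : Site d) m) (g.Fset ℓ 0) ∩ LData.PosOnly (hitW p g ℓ m 0)) ∪
            (LData.PosOnly (hitW p g ℓ m 0))ᶜ) :=
          measureReal_mono (fun ω hω => by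
            by_cases h : ω ∈ LData.PosOnly (hitW p g ℓ m 0)
            · exact Or.inl ⟨hω, h⟩
            · exact Or.inr h) (measure_ne_top _ _)
      _ ≤ _ := measureReal_union_le _ _
      _ = 0 := by rw [hempty, hnull, measureReal_empty, add_zero]
  rw [hzero] at hlook
  norm_num at hlook

/-- **One FK-hittable geometry forces free percolation** (`q ≥ 1`, `d ≥ 1`, every `p`): `IsHittableFK q p g →
0 < θ⁰(p,q)`. [cite: Grimmett2006, Thm. (3.7), eq. (3.4), eq. (3.22), §5.1 (5.1); KozmaNitzan2024, §4 p. 16 (hittable geometry)] -/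
theorem thetaFree_pos_of_isHittableFK [NeZero d] {q : ℝ} (hq : 1 ≤ q) {p : unitInterval} {g : Geom d}
    (hg : IsHittableFK q p g) : 0 < thetaFree d p q := by
  rcases eq_or_lt_of_le p.2.1 with hp0 | hp0
  · exact absurd hg (not_isHittableFK_of_coe_eq_zero hq hp0.symm g)
  · exact thetaFree_pos_of_isHittableFK_of_pos hq hp0 hg

/-- Contrapositive: **where the free model does not percolate, NO geometry is FK-hittable** (`q ≥ 1`, `d ≥ 1`).
[cite: Grimmett2006, §5.1 (5.1)–(5.3); KozmaNitzan2024, §4 p. 16] -/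
theorem not_isHittableFK_of_thetaFree_eq_zero [NeZero d] {q : ℝ} (hq : 1 ≤ q) {p : unitInterval}
    (hθ : thetaFree d p q = 0) (g : Geom d) : ¬ IsHittableFK q p g := fun hg =>
  (thetaFree_pos_of_isHittableFK hq hg).ne' hθ

/-! ### 6. Binder 1: `FH` forces free percolation, `p_c(q) ≤ p`, and is monotone in `p` -/

/-- **`FH d q p → 0 < θ⁰(p,q)`** (`q ≥ 1`, `d ≥ 1`): the hypothesis of record of `ufsc0_of_freeBoundaryHypothesis_r3`
lives inside the free percolative phase — the kernel form of "FH FAILS at `p_c(q)` wherever `θ⁰(p_c(q), q) = 0`"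
(docstring of `FH`). One quarter-face geometry suffices. [cite: KozmaNitzan2024, §4 Lemma 9 (p. 16); Grimmett2006, §5.1 (5.1), Conj. (5.103)] -/
theorem thetaFree_pos_of_fh [NeZero d] {q : ℝ} (hq : 1 ≤ q) {p : unitInterval} (h : FH d q p) : 0 < thetaFree d p q :=
  thetaFree_pos_of_isHittableFK hq (h _ (qfGeom_mem_qfList (0 : Fin d) fun _ => 1))

/-- **`FH d q p → p_c(q) ≤ p`** (`q ≥ 1`, `d ≥ 1`): binder 1 never holds below the critical point. With T1
(`fh_of_criticalProb_lt_ratio`): `p_c(q) ≤ inf {p | FH d q p} ≤ q·p_c(ℤ^d)/(1+(q-1)·p_c(ℤ^d))`.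
[cite: Grimmett2006, §5.1 (5.2)–(5.3), Conj. (5.103); KozmaNitzan2024, §4 Lemma 9 (p. 16)] -/
theorem rcCriticalProb_le_of_fh [NeZero d] {q : ℝ} (hq : 1 ≤ q) {p : unitInterval} (h : FH d q p) :
    rcCriticalProb d q ≤ p :=
  rcCriticalProb_le_of_thetaFree_pos hq p.2 (thetaFree_pos_of_fh hq h)

/-- `¬ FH d q p` wherever `θ⁰(p,q) = 0` (`q ≥ 1`, `d ≥ 1`). [cite: Grimmett2006, §5.1 (5.1), Conj. (5.103)] -/
theorem not_fh_of_thetaFree_eq_zero [NeZero d] {q : ℝ} (hq : 1 ≤ q) {p : unitInterval} (hθ : thetaFree d p q = 0) :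
    ¬ FH d q p := fun h => (thetaFree_pos_of_fh hq h).ne' hθ

/-- `¬ FH d q p` for `p < p_c(q)` (`q ≥ 1`, `d ≥ 1`; there `θ⁰ ≤ θ¹ = 0`). [cite: Grimmett2006, §5.1 (5.2)–(5.3)] -/
theorem not_fh_of_lt_rcCriticalProb [NeZero d] {q : ℝ} (hq : 1 ≤ q) {p : unitInterval}
    (hlt : (p : ℝ) < rcCriticalProb d q) : ¬ FH d q p :=
  not_fh_of_thetaFree_eq_zero hq (thetaFree_eq_zero_of_lt_rcCriticalProb hq p.2.1 hlt)

/-- **`FH` is monotone in `p`** (`q ≥ 1`): `{p | FH d q p}` is an up-set of `[0,1]`, contained in `[p_c(q), 1]`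
(`rcCriticalProb_le_of_fh`) and containing `(q·p_c(ℤ^d)/(1+(q-1)·p_c(ℤ^d)), 1)` (T1). [cite: Grimmett2006, Thm. (3.21), eq. (3.22), Conj. (5.103)] -/
theorem fh_mono_left {q : ℝ} (hq : 1 ≤ q) {p p' : unitInterval} (hpp : p ≤ p') (h : FH d q p) : FH d q p' :=
  fun g hg => (h g hg).mono_left hq hpp

/-! ### 7. Binder 2 is vacuous off the percolative phase -/

/-- **If no geometry is FK-hittable, `KNFreeTargetHittable d q p` holds** (with `δ = 1`, `R = 0`): a family `H` of
FK-hittable geometries is then empty, a target w.r.t. the empty family exists only over an empty box `B`, and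
`φ(o ↔ ∅) = 0` is never `> 1 - 1`. Pure logic on the statement of binder 2; NOT a rule-5 discharge (its hypothesis
`h` is false wherever some geometry is FK-hittable, e.g. in the T1 window).
[cite: KozmaNitzan2024, §4 p. 16 (Definition of a target), Lemma 10 (pp. 17–22)] -/
theorem knFreeTargetHittable_of_forall_not_isHittableFK {q : ℝ} {p : unitInterval}
    (h : ∀ g : Geom d, ¬ IsHittableFK q p g) : KNFreeTargetHittable d q p := by
  intro ε _
  refine ⟨1, one_pos, fun H hH => ⟨0, ?_⟩⟩
  intro W Sfin D lo hi T o _ _ _ _ _ _ htgt _ _ hreach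
  exfalso
  have hB : Finset.Icc lo hi = ∅ := by
    by_contra hne
    obtain ⟨v, hv⟩ := Finset.nonempty_iff_ne_empty.2 hne
    obtain ⟨ℓ, -, g, hg, -⟩ := htgt.hit v (Icc_subset_enlarge lo hi 0 hv)
    exact h g (hH g hg)
  rw [hB] at hreach
  simp only [Finset.notMem_empty, Set.iUnion_of_empty, Set.iUnion_empty, measureReal_empty] at hreach
  linarith

/-- **Binder 2 holds wherever the free model does not percolate** (`q ≥ 1`, `d ≥ 1`): `θ⁰(p,q) = 0 →
KNFreeTargetHittable d q p` — vacuously: no geometry is FK-hittable there (`not_isHittableFK_of_thetaFree_eq_zero`).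
TP_FK has content only in the free percolative phase. [cite: KozmaNitzan2024, §4 Lemma 10 (pp. 17–22); Grimmett2006, §5.1 (5.1)] -/
theorem knFreeTargetHittable_of_thetaFree_eq_zero [NeZero d] {q : ℝ} (hq : 1 ≤ q) {p : unitInterval}
    (hθ : thetaFree d p q = 0) : KNFreeTargetHittable d q p :=
  knFreeTargetHittable_of_forall_not_isHittableFK (not_isHittableFK_of_thetaFree_eq_zero hq hθ)

/-- Binder 2 holds below the critical point (`p < p_c(q)`, `q ≥ 1`, `d ≥ 1`), vacuously; NOT a rule-5 discharge
(the record needs it at a `p` with `θ⁰(p,q) > 0`, where this says nothing).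
[cite: KozmaNitzan2024, §4 Lemma 10 (pp. 17–22); Grimmett2006, §5.1 (5.2)–(5.3)] -/
theorem knFreeTargetHittable_of_lt_rcCriticalProb [NeZero d] {q : ℝ} (hq : 1 ≤ q) {p : unitInterval}
    (hlt : (p : ℝ) < rcCriticalProb d q) : KNFreeTargetHittable d q p :=
  knFreeTargetHittable_of_thetaFree_eq_zero hq (thetaFree_eq_zero_of_lt_rcCriticalProb hq p.2.1 hlt)

/-! ### 8. At criticality: which binder fails -/

/-- **If the free transition is continuous, binder 1 FAILS at `p_c(q)`** (`q ≥ 1`, `d ≥ 1`): `FKContinuityFree d q`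
(the cell's deciding target T_F: `θ⁰(p_c(q), q) = 0`) gives `¬ FH d q p_c(q)`. Decides, under T_F, the alternative
left open by `not_fh_and_targetHittable_at_critical` (`KNFreeTheorem6Consequences.lean`): it is FH that fails.
[cite: Grimmett2006, Conj. (5.103), Conj. (6.32)(a); KozmaNitzan2024, §4 Lemma 9 (p. 16)] -/
theorem not_fh_at_critical_of_fkContinuityFree [NeZero d] {q : ℝ} (hq : 1 ≤ q) (h0 : FKContinuityFree d q) :
    ¬ FH d q ⟨rcCriticalProb d q, rcCriticalProb_mem_Icc d q⟩ :=
  not_fh_of_thetaFree_eq_zero hq h0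

/-- **If the free transition is continuous, binder 2 HOLDS (vacuously) at `p_c(q)`** (`q ≥ 1`, `d ≥ 1`); an instance at
the single point `p = p_c(q)`, NOT a rule-5 discharge.
[cite: KozmaNitzan2024, §4 Lemma 10 (pp. 17–22); Grimmett2006, Conj. (6.32)(a)] -/
theorem knFreeTargetHittable_at_critical_of_fkContinuityFree [NeZero d] {q : ℝ} (hq : 1 ≤ q)
    (h0 : FKContinuityFree d q) : KNFreeTargetHittable d q ⟨rcCriticalProb d q, rcCriticalProb_mem_Icc d q⟩ :=
  knFreeTargetHittable_of_thetaFree_eq_zero hq h0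

/-- **The FK–Ising point, `d ≥ 3`, unconditionally: binder 1 FAILS at `p_c(2)`** — `θ⁰(p_c(2), 2) = 0` is the
tree's `FK.free_two` (Aizenman–Duminil-Copin–Sidoravicius 2015 through `θ⁰ ≤ θ¹`). At the critical point of the
3D Ising model's random-cluster representation the transplant's hypothesis `FH 3 2 p_c(2)` is false and
`KNFreeTargetHittable 3 2 p_c(2)` is (vacuously) true. [cite: AizenmanDuminilCopinSidoraviciusCMP2015, Thm. 1.2 and Cor. 1.5(1)] [cite: Grimmett2006, §5.1 (5.3), Conj. (5.103)] -/
theorem not_fh_two_at_critical (hd : 3 ≤ d) :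
    ¬ FH d 2 ⟨rcCriticalProb d 2, rcCriticalProb_mem_Icc d 2⟩ := by
  haveI : NeZero d := ⟨by omega⟩
  exact not_fh_at_critical_of_fkContinuityFree (by norm_num) (free_two hd)

/-- `q = 2`, `d ≥ 3`: binder 2 holds (vacuously) at the single point `p = p_c(2)` — an instance, NOT a rule-5
discharge (no FK-hittable geometry exists there). [cite: AizenmanDuminilCopinSidoraviciusCMP2015, Cor. 1.5(1)] [cite: KozmaNitzan2024, §4 Lemma 10] -/
theorem knFreeTargetHittable_two_at_critical (hd : 3 ≤ d) :
    KNFreeTargetHittable d 2 ⟨rcCriticalProb d 2, rcCriticalProb_mem_Icc d 2⟩ := by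
  haveI : NeZero d := ⟨by omega⟩
  exact knFreeTargetHittable_at_critical_of_fkContinuityFree (by norm_num) (free_two hd)

/-- **Large `q`, `d ≥ 2`, unconditionally: binder 1 FAILS at `p_c(q)` for every `q > Q(d)`** — the free phase is
subcritical at a first-order point (Grimmett Thm. (7.33)(b), tree `fkContinuityFree_of_large_q`).
[cite: Grimmett2006, Thm. (7.33)(b), Conj. (5.103)] -/
theorem not_fh_at_critical_of_large_q (hd : 2 ≤ d) :
    ∃ Q : ℝ, ∀ q : ℝ, Q < q → 1 ≤ q → ¬ FH d q ⟨rcCriticalProb d q, rcCriticalProb_mem_Icc d q⟩ := by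
  haveI : NeZero d := ⟨by omega⟩
  obtain ⟨Q, hQ⟩ := fkContinuityFree_of_large_q hd
  exact ⟨Q, fun q hQq hq => not_fh_at_critical_of_fkContinuityFree hq (hQ q hQq hq)⟩

/-- Large `q`, `d ≥ 2`: binder 2 holds (vacuously) at the single point `p_c(q)` for every `q > Q(d)` (instance, NOT a
rule-5 discharge).
[cite: Grimmett2006, Thm. (7.33)(b); KozmaNitzan2024, §4 Lemma 10] -/
theorem knFreeTargetHittable_at_critical_of_large_q (hd : 2 ≤ d) :
    ∃ Q : ℝ, ∀ q : ℝ, Q < q → 1 ≤ q → KNFreeTargetHittable d q ⟨rcCriticalProb d q, rcCriticalProb_mem_Icc d q⟩ := by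
  haveI : NeZero d := ⟨by omega⟩
  obtain ⟨Q, hQ⟩ := fkContinuityFree_of_large_q hd
  exact ⟨Q, fun q hQq hq => knFreeTargetHittable_at_critical_of_fkContinuityFree hq (hQ q hQq hq)⟩

/-! ### 9. K1 as a kernel statement: C3a is the record plus the CONVERSE of `thetaFree_pos_of_fh` -/

/-- **C3a follows from the record and the converse of `thetaFree_pos_of_fh`.** If free percolation at `p` gave both
open binders — `0 < θ⁰(p,q) → FH d q p ∧ KNFreeTargetHittable d q p` for every `p ∈ (0,1)` (OPEN for `q > 1`: GRC
Conj. (5.103)-calibre, the content K1 names) — then the record `ufsc0_of_freeBoundaryHypothesis_r3` yields the cell's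
crux C3a `FKCriterionOfThetaFree d q ε₀` (`d ≥ 3`, `q ≥ 1`, `ε₀ > 0`). Since `FH d q p → 0 < θ⁰(p,q)` is PROVED
(`thetaFree_pos_of_fh`) and binder 2 is vacuous where `θ⁰ = 0`, this hypothesis `hconv` is EXACTLY the programme's
open content; nothing here asserts it. CONDITIONAL; not a discharge, not `_r4`. Composed with
`fkContinuityFree_of_criterionOfThetaFree` (`NoCriterionAtCritical.lean` §8) this gives `hconv → FKContinuityFree d q`
for `d ≥ 3`; only the `p = p_c(q)` instance of `hconv` is consumed there, and by
`not_fh_and_targetHittable_at_critical` / `criterionOfThetaFree_at_critical_iff_fkContinuityFree` that instance is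
equivalent to `FKContinuityFree d q` itself (FO-18 memo PHASE2A-MEMO.md: input ≡ target at `p_c`) — a CALIBRATION of
what remains open (K1), not a reduction of T_F to something weaker (R57 (β)).
[cite: Grimmett2006, Conj. (5.103); KozmaNitzan2024, §4 Theorem 6 (pp. 25–31)] -/
theorem fkCriterionOfThetaFree_of_converse (hd : 3 ≤ d) {q ε₀ : ℝ} (hq : 1 ≤ q) (hε₀ : 0 < ε₀)
    (hconv : ∀ p : unitInterval, 0 < (p : ℝ) → (p : ℝ) < 1 → 0 < thetaFree d p q →
      FH d q p ∧ KNFreeTargetHittable d q p) :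
    FKCriterionOfThetaFree d q ε₀ := fun p hp0 hp1 hθ =>
  ufsc0_of_freeBoundaryHypothesis_r3 hd hq hε₀ p ⟨hp0, hp1⟩ (hconv p hp0 hp1 hθ).1 (hconv p hp0 hp1 hθ).2

end Summit.CriticalPhenomena.PercolationContinuityZ3.Theorems.FK

end
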